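import Summits.Ventures.HSemireg.WedgeHankelRecurrenceGaussRadauUnique

/-!
# Venture HSemireg — **THE OFF-DIAGONAL RECURRENCE COEFFICIENTS ARE BOUNDED BY THE SPREAD OF THE SUPPORT: `b_{n+1} ≤ ((B − A)∕2)²`** for a discrete positive measure whose nodes lie in `[A, B]`
# (`n + 1 < N`): `h_{n+1} = Σ ν (w − m) q_n q_{n+1}` for ANY `m` (N273), Cauchy–Schwarz with `m = (A+B)∕2`, and `b_{n+1} = h_{n+1}∕h_n` (N303); together with N303 `a_n ∈ [A, B]` this bounds the whole
# Jacobi matrix by the convex hull of the support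

HONEST FRAMING. Part of the Lean index of the computation cell `pub-hsemireg` (seat p10 gen 44, Sunday typer «UNIFORM-IN-n»).  Real polynomials and finite sums only (one Cauchy–Schwarz inequality
for finite sums, Mathlib `Finset.sum_mul_sq_le_sq_mul_sq`); no variety, no cohomology theory, no sheaf, no Ext group and no semiregularity map is constructed here; nothing here says that
HC / HC_CM / HC_AV holds; no Literature fact (unproved `Prop`) is declared or used.  Custodian versions as in `WedgeHankelSiegelIdeal` (1/3).
SOURCES (cited).  T. S. Chihara, *An Introduction to Orthogonal Polynomials* (1978) Ch. IV §2 (bounds for the recursion coefficients when the true interval of orthogonality is bounded);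
G. Szegő, *Orthogonal Polynomials* §3.2; W. Gautschi, *Orthogonal Polynomials: Computation and Approximation* (2004) §1.3.1.  (The bound is attained: for `n = 0` and `ν = (δ_A + δ_B)∕2`,
`b_1 = ((B−A)∕2)²`.)
PROOF TYPED HERE.  `h_{n+1} = Σ_l ν_l (w_l − m) q_n(w_l) q_{n+1}(w_l)` with `m = (A+B)∕2` (N273 `sum_mul_eval_mul_eq_sum_sq_of_monic`), then `h_{n+1}² ≤ (Σ ν (w−m)² q_n²)·h_{n+1} ≤ ((B−A)∕2)² h_n h_{n+1}`,
and `b_{n+1} h_n = h_{n+1}` (N303).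
DEDUP DISCLOSURE (`rg -n 'offDiagonal_le|b_le_spread|sq_spread' Summits/Ventures/HSemireg`, 2026-09-03): N303 `a_mem_Icc_support` bounds the DIAGONAL coefficients by the support; the off-diagonal
bound is new.  The 3 names below: 0 hits tree-wide.

WHAT IS IN THE TREE.  N273 `sum_mul_eval_mul_eq_sum_sq_of_monic`, `sum_mul_eval_sq_pos_of_natDegree_lt`; N303 `b_eq_norm_div_norm`; N279 `recurrence_monic_natDegree`; Mathlib
`Finset.sum_mul_sq_le_sq_mul_sq`.
THIS FILE (namespace `Summit.Ventures.HSemireg.Wedge.HankelOuter` continued; CHAINED on N343 (import only); 0 definitions):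
* §1109 `norm_succ_eq_sum_centered` (`h_{n+1} = Σ ν (w − m) q_n q_{n+1}` for every `m`), **`norm_succ_le_sq_spread_mul_norm`** (`h_{n+1} ≤ ((B−A)∕2)² h_n` when `A ≤ w_l ≤ B`),
  **`offDiagonal_le_sq_half_spread`** (`b_{n+1} ≤ ((B − A)∕2)²`).
CAVEATS.  Discrete positive measures, distinct nodes, `n + 1 < N`.  Nothing Ext-side.  New names only.
-/

open Module Polynomial
open scoped Matrix Polynomial

namespace Summit.Ventures.HSemireg.Wedge.HankelOuter

/-! ## §1109. The off-diagonal coefficients and the spread of the support -/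

/-- **`h_{n+1} = Σ_l ν_l (w_l − m) q_n(w_l) q_{n+1}(w_l)` for every real `m`.** [N273 repackaged; this file, §1109] -/
theorem norm_succ_eq_sum_centered {N : ℕ} {ν w : Fin N → ℝ} {q : ℕ → ℝ[X]} {a b : ℕ → ℝ} (hq0 : q 0 = 1) (hq1 : q 1 = Polynomial.X - C (a 0))
    (hrec : ∀ n, q (n + 2) = (Polynomial.X - C (a (n + 1))) * q (n + 1) - C (b (n + 1)) * q n) (n : ℕ)
    (horth : ∀ G : ℝ[X], G.natDegree < n + 1 → ∑ l, ν l * (q (n + 1) * G).eval (w l) = 0) (m : ℝ) :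
    ∑ l, ν l * ((q (n + 1)).eval (w l)) ^ 2 = ∑ l, ν l * ((w l - m) * ((q n).eval (w l) * (q (n + 1)).eval (w l))) := by
  have hmd := recurrence_monic_natDegree hq0 hq1 hrec
  have h := sum_mul_eval_mul_eq_sum_sq_of_monic (by omega : 1 ≤ n + 1) (hmd n).1 (by rw [(hmd n).2]; rfl) (hmd (n + 1)).1 (hmd (n + 1)).2 horth m
  rw [← h]
  exact Finset.sum_congr rfl fun l _ => by rw [eval_mul, eval_sub, eval_X, eval_C]; ring

/-- **`h_{n+1} ≤ ((B − A)∕2)² h_n` when all nodes lie in `[A, B]`** (Cauchy–Schwarz around the midpoint). [Chihara Ch. IV §2; this file, §1109] -/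
theorem norm_succ_le_sq_spread_mul_norm {N : ℕ} {ν w : Fin N → ℝ} (hν : ∀ l, 0 ≤ ν l) {A B : ℝ} (hA : ∀ l, A ≤ w l) (hB : ∀ l, w l ≤ B)
    {q : ℕ → ℝ[X]} {a b : ℕ → ℝ} (hq0 : q 0 = 1) (hq1 : q 1 = Polynomial.X - C (a 0))
    (hrec : ∀ n, q (n + 2) = (Polynomial.X - C (a (n + 1))) * q (n + 1) - C (b (n + 1)) * q n) (n : ℕ)
    (horth : ∀ G : ℝ[X], G.natDegree < n + 1 → ∑ l, ν l * (q (n + 1) * G).eval (w l) = 0) :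
    ∑ l, ν l * ((q (n + 1)).eval (w l)) ^ 2 ≤ ((B - A) / 2) ^ 2 * ∑ l, ν l * ((q n).eval (w l)) ^ 2 := by
  set m := (A + B) / 2 with hm
  have hid := norm_succ_eq_sum_centered hq0 hq1 hrec n horth m
  -- Cauchy–Schwarz with `f = √ν (w − m) q_n`, `g = √ν q_{n+1}`
  have hcs := Finset.sum_mul_sq_le_sq_mul_sq Finset.univ (fun l => Real.sqrt (ν l) * ((w l - m) * (q n).eval (w l))) (fun l => Real.sqrt (ν l) * (q (n + 1)).eval (w l))
  have hsq : ∀ l, Real.sqrt (ν l) * Real.sqrt (ν l) = ν l := fun l => Real.mul_self_sqrt (hν l)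
  have e1 : ∑ l, Real.sqrt (ν l) * ((w l - m) * (q n).eval (w l)) * (Real.sqrt (ν l) * (q (n + 1)).eval (w l)) = ∑ l, ν l * ((w l - m) * ((q n).eval (w l) * (q (n + 1)).eval (w l))) :=
    Finset.sum_congr rfl fun l _ => by
      rw [show Real.sqrt (ν l) * ((w l - m) * (q n).eval (w l)) * (Real.sqrt (ν l) * (q (n + 1)).eval (w l)) =
        (Real.sqrt (ν l) * Real.sqrt (ν l)) * ((w l - m) * ((q n).eval (w l) * (q (n + 1)).eval (w l))) by ring, hsq l]
  have e2 : ∑ l, (Real.sqrt (ν l) * ((w l - m) * (q n).eval (w l))) ^ 2 = ∑ l, ν l * ((w l - m) ^ 2 * ((q n).eval (w l)) ^ 2) :=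
    Finset.sum_congr rfl fun l _ => by rw [mul_pow, Real.sq_sqrt (hν l)]; ring
  have e3 : ∑ l, (Real.sqrt (ν l) * (q (n + 1)).eval (w l)) ^ 2 = ∑ l, ν l * ((q (n + 1)).eval (w l)) ^ 2 :=
    Finset.sum_congr rfl fun l _ => by rw [mul_pow, Real.sq_sqrt (hν l)]
  rw [e1, e2, e3, ← hid] at hcs
  -- `(w − m)² ≤ ((B − A)/2)²`
  have hdev : ∑ l, ν l * ((w l - m) ^ 2 * ((q n).eval (w l)) ^ 2) ≤ ((B - A) / 2) ^ 2 * ∑ l, ν l * ((q n).eval (w l)) ^ 2 := by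
    rw [Finset.mul_sum]
    refine Finset.sum_le_sum fun l _ => ?_
    have h1 : (w l - m) ^ 2 ≤ ((B - A) / 2) ^ 2 := sq_le_sq' (by rw [hm]; linarith [hA l, hB l]) (by rw [hm]; linarith [hA l, hB l])
    nlinarith [mul_nonneg (hν l) (sq_nonneg ((q n).eval (w l))), h1]
  -- `h_{n+1}² ≤ (((B−A)/2)² h_n) h_{n+1}`
  have hH : 0 ≤ ∑ l, ν l * ((q (n + 1)).eval (w l)) ^ 2 := Finset.sum_nonneg fun l _ => mul_nonneg (hν l) (sq_nonneg _)
  rcases hH.eq_or_lt with h0 | hpos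
  · rw [← h0]; exact mul_nonneg (sq_nonneg _) (Finset.sum_nonneg fun l _ => mul_nonneg (hν l) (sq_nonneg _))
  · nlinarith [hcs, hdev]

/-- **`b_{n+1} ≤ ((B − A)∕2)²` for a discrete positive measure with distinct nodes in `[A, B]` (`n + 1 < N`).** [Chihara Ch. IV §2; this file, §1109] -/
theorem offDiagonal_le_sq_half_spread {N : ℕ} {ν w : Fin N → ℝ} (hν : ∀ l, 0 < ν l) (hw : Function.Injective w) {A B : ℝ} (hA : ∀ l, A ≤ w l) (hB : ∀ l, w l ≤ B)
    {q : ℕ → ℝ[X]} {a b : ℕ → ℝ} (hq0 : q 0 = 1) (hq1 : q 1 = Polynomial.X - C (a 0))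
    (hrec : ∀ n, q (n + 2) = (Polynomial.X - C (a (n + 1))) * q (n + 1) - C (b (n + 1)) * q n) {n : ℕ} (hnN : n < N)
    (horth : ∀ k, k ≤ n + 2 → ∀ G : ℝ[X], G.natDegree < k → ∑ l, ν l * (q k * G).eval (w l) = 0) : b (n + 1) ≤ ((B - A) / 2) ^ 2 := by
  have hmd := recurrence_monic_natDegree hq0 hq1 hrec
  have hpos : 0 < ∑ l, ν l * ((q n).eval (w l)) ^ 2 := sum_mul_eval_sq_pos_of_natDegree_lt hν hw (hmd n).1.ne_zero (by rw [(hmd n).2]; exact hnN)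
  rw [b_eq_norm_div_norm hν hw hq0 hq1 hrec hnN horth, div_le_iff₀ hpos]
  exact norm_succ_le_sq_spread_mul_norm (fun l => (hν l).le) hA hB hq0 hq1 hrec n (horth (n + 1) (by omega))

end Summit.Ventures.HSemireg.Wedge.HankelOuter
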